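import Literature.NumberTheory.EllipticCurves.IsogenyOddKernelDiscriminantProofs
import HarnessLib

/-!
# Coates' lemma / Dokchitser–Dokchitser 2015 Thm. 3 in `K`: `Δ(E)ⁿ = Δ(E')·c¹²` with `c ∈ K`
# for a `K`-isogeny with cyclic kernel of order `n` prime to `6` (Galois descent of the
# twelfth root; proofs only)

Topic `NumberTheory/EllipticCurves`; THEOREMS ONLY; sequel of
`IsogenyOddKernelDiscriminantProofs` (`Δ(E)ⁿ = Δ(E')·(u·g)¹²` in `K̄` with `u ∈ Kˣ` and
`g = Π_{k=1}^{m}(x(kP) - x(2kP))`, `n = 2m + 1`). Here the explicit twelfth root `g` is shown to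
lie in `K`: the kernel `⟨P⟩` of a `K`-isogeny is `Γ_K`-stable, so `σP = aP` with `a` prime to
`n`, `σ` permutes the factors `x(kP) - x(2kP)` through `k ↦ ±ak (mod n)` (`x(-Q) = x(Q)`), and
`K̄^{Γ_K} = K`. Main result:

**`Isogeny.exists_Δ_pow_eq_mul_pow_twelve`** — for a `K`-isogeny `φ : E → E'` of elliptic curves
over a number field `K`, `E : y² = x³ + a₄x + a₆`, with kernel `⟨P⟩` cyclic of order
`n = 2m + 1` prime to `3`: there is `c ∈ K` with `Δ(E)ⁿ = Δ(E')·c¹²`. This is J. Coates' lemma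
(Bull. LMS 23 (1991), appendix, Thm. 8) = Dokchitser–Dokchitser, Trans. AMS 367 (2015), §2 Thm. 3
(«`Δ^p/Δ'` is a `12`-th power in `𝒦`» for a `p`-isogeny, `p > 3`), with an algebraic proof and for
every cyclic kernel of order prime to `6`.

## References
* [DokchitserDokchitser2015LocalInvariants] §2 Thm. 3 (Coates).
* [SilvermanAEC2009] III.4 (Galois-stable kernels), Exercise 3.7.
-/

noncomputable section

open scoped Classical

open Finset

universe u

namespace WeierstrassCurve

namespace Isogeny

open geomPoints Affine Affine.Point Literature.NumberTheory.EllipticCurves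

variable {K : Type u} [Field K] {W : WeierstrassCurve K}

/-! ### Reduction of multiples modulo the order, and the half-system reindexing -/

/-- `x(R) = xy R 0`. Private plumbing. [folklore] -/
private theorem xOf_eq_xy (R : W.geomPoints) :
    xOf (R : (W⁄(AlgebraicClosure K)).toAffine.Point) = xy R 0 := by
  rcases R with _ | ⟨x, y, h⟩ <;> rfl

/-- `x(σ • R) = σ(x(R))`. Private plumbing. [folklore] -/
private theorem xOf_smul (σ : Field.absoluteGaloisGroup K) (R : W.geomPoints) :
    xOf ((σ • R : W.geomPoints) : (W⁄(AlgebraicClosure K)).toAffine.Point) =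
      galAut K σ (xOf (R : (W⁄(AlgebraicClosure K)).toAffine.Point)) := by
  rw [xOf_eq_xy, xOf_eq_xy, geomPoints.xy_smul]

/-- `x(-R) = x(R)` on `E(K̄)`. Private plumbing. [folklore] -/
private theorem xOf_neg_geom (R : W.geomPoints) :
    xOf ((-R : W.geomPoints) : (W⁄(AlgebraicClosure K)).toAffine.Point) =
      xOf (R : (W⁄(AlgebraicClosure K)).toAffine.Point) := by
  rcases R with _ | ⟨x, y, h⟩ <;> rfl

/-- `jP = (j mod n)P` when `nP = O`. Private plumbing. [folklore] -/
private theorem natCast_zsmul_eq_mod (P : W.geomPoints) {n : ℕ} (hn : (n : ℤ) • P = 0) (j : ℕ) :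
    (j : ℤ) • P = ((j % n : ℕ) : ℤ) • P := by
  conv_lhs => rw [← Nat.div_add_mod j n]
  push_cast
  rw [add_zsmul, mul_comm, mul_zsmul, hn, zsmul_zero, zero_add]

/-- **`x(jP) - x(2jP)` only depends on `±j mod n`**: with `ρ(j) = j mod n` or `n - (j mod n)`
(whichever is `≤ m`), `x(jP) - x(2jP) = x(ρ(j)P) - x(2ρ(j)P)` (`x(-Q) = x(Q)`). Private plumbing.
[folklore] -/
private theorem xOf_sub_eq_rho (P : W.geomPoints) {n m : ℕ} (hnm : n = 2 * m + 1)
    (hn : (n : ℤ) • P = 0) (j : ℕ) :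
    xOf (((j : ℤ) • P : W.geomPoints) : (W⁄(AlgebraicClosure K)).toAffine.Point) -
        xOf (((2 * j : ℤ) • P : W.geomPoints) : (W⁄(AlgebraicClosure K)).toAffine.Point) =
      xOf ((((if j % n ≤ m then j % n else n - j % n : ℕ) : ℤ) • P : W.geomPoints) :
          (W⁄(AlgebraicClosure K)).toAffine.Point) -
        xOf (((2 * ((if j % n ≤ m then j % n else n - j % n : ℕ) : ℤ)) • P : W.geomPoints) :
          (W⁄(AlgebraicClosure K)).toAffine.Point) := by
  have h2 : ∀ i : ℤ, (2 * i) • P = (2 : ℤ) • (i • P) := fun i => mul_zsmul P 2 i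
  rw [h2, h2, natCast_zsmul_eq_mod P hn j]
  split_ifs with hj
  · rfl
  · have hlt : j % n < n := Nat.mod_lt _ (by omega)
    have e : (((j % n : ℕ) : ℤ)) • P = -((((n - j % n : ℕ) : ℤ)) • P) := by
      rw [Nat.cast_sub hlt.le, sub_zsmul, hn]
      simp
    rw [e, zsmul_neg, xOf_neg_geom, xOf_neg_geom]

/-- The reduction map `k ↦ ρ(ak)` sends `[1, m]` to `[1, m]` (`a` prime to `n = 2m + 1`).
Private plumbing. [folklore] -/
private theorem rho_mem_Icc {n m : ℕ} (hnm : n = 2 * m + 1) {a : ℕ} (ha : a.Coprime n) {k : ℕ}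
    (hk : k ∈ Icc 1 m) :
    (if a * k % n ≤ m then a * k % n else n - a * k % n) ∈ Icc 1 m := by
  rw [mem_Icc] at hk ⊢
  have hn : 0 < n := by omega
  have hndvd : ¬ n ∣ a * k := by
    intro h
    have hk' : n ∣ k := ha.symm.dvd_of_dvd_mul_left h
    exact absurd (Nat.le_of_dvd (by omega) hk') (by omega)
  have hmod0 : a * k % n ≠ 0 := fun h => hndvd (Nat.dvd_of_mod_eq_zero h)
  have hlt : a * k % n < n := Nat.mod_lt _ hn
  split_ifs with h
  · exact ⟨Nat.pos_of_ne_zero hmod0, h⟩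
  · constructor <;> omega

/-- The reduction map `k ↦ ρ(ak)` is injective on `[1, m]` (`a` prime to `n = 2m + 1`).
Private plumbing. [folklore] -/
private theorem rho_injOn {n m : ℕ} (hnm : n = 2 * m + 1) {a : ℕ} (ha : a.Coprime n) :
    Set.InjOn (fun k : ℕ => if a * k % n ≤ m then a * k % n else n - a * k % n)
      (Icc 1 m : Finset ℕ) := by
  intro k hk k' hk' h
  simp only [coe_Icc, Set.mem_Icc] at hk hk'
  simp only at h
  have hn : 0 < n := by omega
  have hlt : a * k % n < n := Nat.mod_lt _ hn
  have hlt' : a * k' % n < n := Nat.mod_lt _ hn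
  have same : a * k % n = a * k' % n → k = k' := by
    intro hmm
    have h1 : a * k ≡ a * k' [MOD n] := hmm
    have h2 : k ≡ k' [MOD n] := Nat.ModEq.cancel_left_of_coprime (by simpa using ha.symm) h1
    exact Nat.ModEq.eq_of_lt_of_lt h2 (by omega) (by omega)
  have opp : a * k % n + a * k' % n = n → False := by
    intro hsum
    have h1 : a * (k + k') ≡ 0 [MOD n] := by
      rw [mul_add, Nat.ModEq, Nat.add_mod, hsum, Nat.mod_self, Nat.zero_mod]
    have h2 : n ∣ a * (k + k') := Nat.modEq_zero_iff_dvd.mp h1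
    have h3 : n ∣ k + k' := ha.symm.dvd_of_dvd_mul_left h2
    exact absurd (Nat.le_of_dvd (by omega) h3) (by omega)
  split_ifs at h with h₁ h₂ h₂
  · exact same h
  · exact (opp (by omega)).elim
  · exact (opp (by omega)).elim
  · exact same (by omega)

/-- **The half-system product is invariant under `k ↦ ak`** (`a` prime to `n = 2m + 1`,
`nP = O`): `Π_{k=1}^{m}(x(akP) - x(2akP)) = Π_{k=1}^{m}(x(kP) - x(2kP))`.
[cite: SilvermanAEC2009, III.4 (the kernel as a Galois module; symmetric functions of the kernel)] -/
theorem prod_xOf_mul_sub_eq (P : W.geomPoints) {n m : ℕ} (hnm : n = 2 * m + 1)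
    (hn : (n : ℤ) • P = 0) {a : ℕ} (ha : a.Coprime n) :
    ∏ k ∈ Icc 1 m, (xOf ((((a * k : ℕ) : ℤ) • P : W.geomPoints) :
        (W⁄(AlgebraicClosure K)).toAffine.Point) -
      xOf (((2 * ((a * k : ℕ) : ℤ)) • P : W.geomPoints) :
        (W⁄(AlgebraicClosure K)).toAffine.Point)) =
    ∏ k ∈ Icc 1 m, (xOf ((((k : ℕ) : ℤ) • P : W.geomPoints) :
        (W⁄(AlgebraicClosure K)).toAffine.Point) -
      xOf (((2 * ((k : ℕ) : ℤ)) • P : W.geomPoints) :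
        (W⁄(AlgebraicClosure K)).toAffine.Point)) := by
  set ρ : ℕ → ℕ := fun k => if a * k % n ≤ m then a * k % n else n - a * k % n with hρ
  have hmaps : ∀ k ∈ Icc 1 m, ρ k ∈ Icc 1 m := fun k hk => rho_mem_Icc hnm ha hk
  have hinj : Set.InjOn ρ (Icc 1 m : Finset ℕ) := rho_injOn hnm ha
  have hsurj : Set.SurjOn ρ (Icc 1 m : Finset ℕ) (Icc 1 m : Finset ℕ) := by
    intro b hb
    obtain ⟨k, hk, hkb⟩ := surj_on_of_inj_on_of_card_le (s := Icc 1 m) (t := Icc 1 m)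
      (fun k _ => ρ k) (fun k hk => hmaps k hk) (fun k₁ k₂ h₁ h₂ h => hinj h₁ h₂ h) le_rfl b hb
    exact ⟨k, hk, hkb.symm⟩
  exact prod_nbij ρ hmaps hinj hsurj fun k _ => xOf_sub_eq_rho P hnm hn (a * k)

/-! ### Galois descent of the twelfth root -/

/-- If `σP = aP` for a point `P` of exact order `n` and a Galois automorphism `σ`, then `a` is
prime to `n` (`σP` has order `n` as well). Private plumbing. [folklore] -/
private theorem coprime_of_smul_eq (P : W.geomPoints) {n : ℕ} (hn : (n : ℤ) • P = 0)
    (hmin : ∀ k : ℕ, 0 < k → k < n → (k : ℤ) • P ≠ 0) (h1n : 1 < n)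
    (σ : Field.absoluteGaloisGroup K) {a : ℕ} (ha : σ • P = (a : ℤ) • P) : a.Coprime n := by
  by_contra hcop
  set d := Nat.gcd a n with hd
  have hdn : d ∣ n := Nat.gcd_dvd_right a n
  have hda : d ∣ a := Nat.gcd_dvd_left a n
  have hd0 : 0 < d := Nat.pos_of_ne_zero (by
    intro h0; rw [hd, Nat.gcd_eq_zero_iff] at h0; omega)
  have hd1 : d ≠ 1 := hcop
  obtain ⟨q, hq⟩ := hdn
  obtain ⟨b, hb⟩ := hda
  have hq0 : 0 < q := Nat.pos_of_ne_zero (by rintro rfl; omega)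
  have hqn : q < n := by
    have : 2 ≤ d := by omega
    nlinarith
  -- `q • (σ • P) = σ • (q • P) ≠ 0`, but `q • (a • P) = b • (n • P) = 0`
  have hcomm : σ • ((q : ℤ) • P) = (q : ℤ) • (σ • P) := by
    simpa using map_zsmul (DistribSMul.toAddMonoidHom W.geomPoints σ) (q : ℤ) P
  have hne : (q : ℤ) • (σ • P) ≠ 0 := by
    rw [← hcomm, smul_ne_zero_iff_ne]
    exact hmin q hq0 hqn
  apply hne
  rw [ha, smul_smul, show ((q : ℤ) * a) = (b : ℤ) * n by
    rw [hb]; push_cast; rw [hq]; push_cast; ring, ← smul_smul, hn, smul_zero]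

/-- **The twelfth root is `Γ_K`-invariant**: for a point `P ∈ E(K̄)` of exact order
`n = 2m + 1` whose cyclic group is `Γ_K`-stable (`σP ∈ ⟨P⟩` for all `σ`), the product
`Π_{k=1}^{m}(x(kP) - x(2kP))` lies in `K` (`K` perfect: `K̄^{Γ_K} = K`). [cite: SilvermanAEC2009, Rem. III.4.13.2 (quotients by Galois-stable subgroups are defined over `K`)] -/
theorem prod_xOf_sub_mem_range [PerfectField K] (P : W.geomPoints) {n m : ℕ} (hnm : n = 2 * m + 1)
    (h1n : 1 < n) (hn : (n : ℤ) • P = 0) (hmin : ∀ k : ℕ, 0 < k → k < n → (k : ℤ) • P ≠ 0)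
    (hstab : ∀ σ : Field.absoluteGaloisGroup K, ∃ a : ℕ, σ • P = (a : ℤ) • P) :
    ∏ k ∈ Icc 1 m, (xOf ((((k : ℕ) : ℤ) • P : W.geomPoints) :
        (W⁄(AlgebraicClosure K)).toAffine.Point) -
      xOf (((2 * ((k : ℕ) : ℤ)) • P : W.geomPoints) :
        (W⁄(AlgebraicClosure K)).toAffine.Point)) ∈
      Set.range (algebraMap K (AlgebraicClosure K)) := by
  haveI : IsGalois K (AlgebraicClosure K) := {}
  refine (InfiniteGalois.mem_range_algebraMap_iff_fixed _).mpr fun f => ?_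
  set σ : Field.absoluteGaloisGroup K := f
  obtain ⟨a, ha⟩ := hstab σ
  have hcop : a.Coprime n := coprime_of_smul_eq P hn hmin h1n σ ha
  have hsmul : ∀ j : ℤ, σ • (j • P) = (j * a : ℤ) • P := fun j => by
    have hcomm : σ • (j • P) = j • (σ • P) := by
      simpa using map_zsmul (DistribSMul.toAddMonoidHom W.geomPoints σ) j P
    rw [hcomm, ha, smul_smul]
  rw [show (f : AlgebraicClosure K → AlgebraicClosure K) = galAut K σ from rfl, map_prod]
  rw [← prod_xOf_mul_sub_eq P hnm hn hcop]
  refine prod_congr rfl fun k _ => ?_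
  rw [map_sub, ← xOf_smul, ← xOf_smul, hsmul, hsmul]
  push_cast
  ring_nf

variable {W' : WeierstrassCurve K} [W.IsElliptic] [W'.IsElliptic]

/-- **Coates' lemma / Dokchitser–Dokchitser 2015, Thm. 3, in `K`, for every cyclic kernel of
order prime to `6`.** Let `K` be a number field, `E : y² = x³ + a₄x + a₆` an elliptic curve over
`K`, and `φ : E → E'` a `K`-isogeny of elliptic curves whose kernel is the cyclic group generated
by a point `P = (x₀, y₀) ∈ E(K̄)` of exact order `n = 2m + 1` with `3 ∤ n`. Then there is
`c ∈ K` with `Δ(E)ⁿ = Δ(E')·c¹²` (explicitly `c = u·Π_{k=1}^{m}(x(kP) - x(2kP))`, `u` the scaling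
of `E/⟨P⟩ ≅ E'`). Printed for `n = p > 3` prime («`Δ^p/Δ'` is a `12`-th power»), proved there
analytically; here algebraically, from Vélu's formulae, Ward's symmetry of the division values,
the uniqueness of the quotient, and Galois descent.
[cite: DokchitserDokchitser2015LocalInvariants, §2 Thm. 3 (Coates, Bull. LMS 23 (1991), appendix Thm. 8)] -/
theorem exists_Δ_pow_eq_mul_pow_twelve [NumberField K] [W.IsShortNF] (φ : Isogeny W W')
    {x₀ y₀ : AlgebraicClosure K}
    (h : (W⁄(AlgebraicClosure K)).toAffine.Nonsingular x₀ y₀) {n m : ℕ} (hnm : n = 2 * m + 1)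
    (h3 : Nat.Coprime 3 n) (h1n : 1 < n) (hn : (n : ℤ) • Point.some x₀ y₀ h = 0)
    (hmin : ∀ k : ℕ, 0 < k → k < n → (k : ℤ) • Point.some x₀ y₀ h ≠ 0)
    (hker : ∀ Q : W.geomPoints, Q ∈ φ.toAddMonoidHom.ker ↔
      Q ∈ (range n).image fun k : ℕ => (k : ℤ) • Point.some x₀ y₀ h) :
    ∃ c : K, W.Δ ^ n = W'.Δ * c ^ 12 := by
  obtain ⟨u, hu⟩ := φ.exists_unit_Δ_pow_eq_mul_pow_twelve h hnm h3 h1n hn hmin hker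
  set P : W.geomPoints := Point.some x₀ y₀ h with hPdef
  -- `⟨P⟩ = ker φ` is `Γ_K`-stable
  have hPker : P ∈ φ.toAddMonoidHom.ker := by
    refine (hker P).mpr ?_
    have h1 := Finset.mem_image_of_mem (fun k : ℕ => (k : ℤ) • Point.some x₀ y₀ h)
      (mem_range.mpr h1n)
    rwa [Nat.cast_one, one_zsmul] at h1
  have hstab : ∀ σ : Field.absoluteGaloisGroup K, ∃ a : ℕ, σ • P = (a : ℤ) • P := by
    intro σ
    have hσ : σ • P ∈ φ.toAddMonoidHom.ker := by
      rw [AddMonoidHom.mem_ker, coe_toAddMonoidHom] at hPker ⊢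
      rw [φ.map_smul, hPker, smul_zero]
    obtain ⟨a, -, ha⟩ :=
      (Finset.mem_image (β := (W⁄(AlgebraicClosure K)).toAffine.Point)).mp ((hker _).mp hσ)
    exact ⟨a, ha.symm⟩
  obtain ⟨g₀, hg₀⟩ := prod_xOf_sub_mem_range P hnm h1n hn hmin hstab
  have hg₀' : algebraMap K (AlgebraicClosure K) g₀ =
      ∏ k ∈ Icc 1 m, (xOf ((k : ℤ) • Point.some x₀ y₀ h) -
        xOf ((2 * k : ℤ) • Point.some x₀ y₀ h)) := hg₀
  refine ⟨(u : K) * g₀, (algebraMap K (AlgebraicClosure K)).injective ?_⟩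
  rw [map_pow, hu, map_mul, map_pow, map_mul, hg₀']

end Isogeny

end WeierstrassCurve
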